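import Summits.AtomisticToContinuum.Crystallization.Theorems.ExcessDecayLiouvilleHcpLiouvilleSiteDichotomy
import Summits.AtomisticToContinuum.Crystallization.Theorems.ExcessDecayLiouvilleFarField
import Summits.AtomisticToContinuum.Crystallization.Theorems.ExcessDecayLiouvilleHcpLiouvilleDefs

/-!
# `ExcessDecayLiouville.HcpLiouville` (stmt-AtomisticToContinuum-9332), line `Sketch`, level 1: site-set sums and the anchor maps

Geometric book-keeping over the site set `S = Sites₀ t A` of an admissible hcp datum (`Adm₀ A`,
`Inner₀ t A`; sites are `23/25`-separated, `dist_sites_ge`) for the nonlinear Caccioppoli inequality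
`stub_levelOneGrowth` of the line `two-level-caccioppoli` (crux `HcpLiouville`):

* `LevelOne.sum_far_le` / `summable_far` / `tsum_far_le` — the far-field sums
  `Σ_{q ∈ S, dist q p ≥ R} |q − p|^{-(k+3)} ≤ 1024/((23/25)³ Rᵏ)` indexed by the subtype `↥S`
  (`sum_inv_pow_le_of_separated`);
* `LevelOne.ker` — the row-summable kernel `248064·|p − q|⁻⁸` dominating the secant force-constant
  matrices, `summable_ker`, `tsum_ker_le`, its far and `dist²`-weighted partial sums;
* `LevelOne.card_sites_le` — `#(S ∩ B_r(c)) ≤ 32 r³` for `r ≥ 1` (packing), `finite_sites_ball`;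
* `LevelOne.dist_le_of_nn` — nearest-neighbour bonds (`dist ≤ 11/10`) have length `≤ 51/50` (`dist_sites_le_or_ge`);
* the anchor shift: `‖τ‖ ≤ 1/20` (`norm_anchor_le`), the sublattice-preserving maps `LevelOne.fwd : s ↦ s + τ𝟙₁(s)`
  (reference sites `S` → anchored sites `S* = Sites₀ (anchorDatum t τ) A`) and `LevelOne.bwd` (its inverse),
  the displacement seen from the anchored sites `LevelOne.vField t A τ u = u ∘ bwd − τ𝟙₁*`
  (`vField ∘ fwd = u − τ𝟙₁`, `p + vField p ∈ X`, `‖vField‖ ≤ 3/40`), and `dist_fwd_fwd_le_of_nn`: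
  nearest-neighbour bonds survive the anchor shift.

All `[folklore]`; a `--supports` helper for item stmt-AtomisticToContinuum-9332, closing nothing.
-/

noncomputable section

namespace Summit.AtomisticToContinuum.Crystallization.Theorems.ExcessDecayLiouville

open scoped BigOperators Topology Classical InnerProductSpace
open Literature.MathematicalPhysics.StatisticalMechanics
open Summit.AtomisticToContinuum.Crystallization.Theses.ExcessDecayLiouville
open Summit.AtomisticToContinuum.Crystallization.Theorems.PhononStabilityNegative

local notation "E3" => EuclideanSpace ℝ (Fin 3)

namespace LevelOne

variable {t : Fin 2 → E3} {A : E3 →L[ℝ] E3}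

/-! ## Far-field sums indexed by the site subtype -/

/-- **Far-field partial sums over sites**: for `R ≥ 23/25`, `k ≥ 1` and a finite set `F` of sites,
`Σ_{q ∈ F, R ≤ dist q p} (dist q p)^{-(k+3)} ≤ 1024/((23/25)³Rᵏ)`. [folklore] -/
theorem sum_far_le (hA : Adm₀ A) (hI : Inner₀ t A) (p : E3) {R : ℝ} (hR : (23 / 25 : ℝ) ≤ R) {k : ℕ}
    (hk : 1 ≤ k) (F : Finset (Sites₀ t A)) :
    ∑ q ∈ F, (if R ≤ dist (q : E3) p then (dist (q : E3) p)⁻¹ ^ (k + 3) else 0) ≤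
      1024 / ((23 / 25 : ℝ) ^ 3 * R ^ k) := by
  rw [← Finset.sum_filter]
  set G : Finset E3 := (F.filter fun q : Sites₀ t A => R ≤ dist (q : E3) p).map
    (Function.Embedding.subtype _) with hG
  have hsum : ∑ q ∈ F.filter (fun q : Sites₀ t A => R ≤ dist (q : E3) p), (dist (q : E3) p)⁻¹ ^ (k + 3) =
      ∑ a ∈ G, (dist a p)⁻¹ ^ (k + 3) := by
    rw [hG, Finset.sum_map]
    rfl
  rw [hsum]
  refine sum_inv_pow_le_of_separated G p hk (by norm_num : (0 : ℝ) < 23 / 25) hR ?_ ?_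
  · intro a ha b hb hab
    simp only [hG, Finset.mem_map, Finset.mem_filter, Function.Embedding.coe_subtype] at ha hb
    obtain ⟨a', -, rfl⟩ := ha
    obtain ⟨b', -, rfl⟩ := hb
    exact dist_sites_ge hA hI a'.2 b'.2 hab
  · intro a ha
    simp only [hG, Finset.mem_map, Finset.mem_filter, Function.Embedding.coe_subtype] at ha
    obtain ⟨a', ⟨-, ha'⟩, rfl⟩ := ha
    exact ha'

/-- The far-field family over the site subtype is summable. [folklore] -/
theorem summable_far (hA : Adm₀ A) (hI : Inner₀ t A) (p : E3) {R : ℝ} (hR : (23 / 25 : ℝ) ≤ R) {k : ℕ}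
    (hk : 1 ≤ k) :
    Summable fun q : Sites₀ t A => if R ≤ dist (q : E3) p then (dist (q : E3) p)⁻¹ ^ (k + 3) else 0 :=
  summable_of_sum_le (fun q => by simp only [Pi.zero_apply]; split_ifs <;> positivity)
    (sum_far_le hA hI p hR hk)

/-- The far-field `tsum` over the site subtype is `≤ 1024/((23/25)³Rᵏ)`. [folklore] -/
theorem tsum_far_le (hA : Adm₀ A) (hI : Inner₀ t A) (p : E3) {R : ℝ} (hR : (23 / 25 : ℝ) ≤ R) {k : ℕ}
    (hk : 1 ≤ k) :
    ∑' q : Sites₀ t A, (if R ≤ dist (q : E3) p then (dist (q : E3) p)⁻¹ ^ (k + 3) else 0) ≤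
      1024 / ((23 / 25 : ℝ) ^ 3 * R ^ k) :=
  tsum_le_of_sum_le' (by positivity) (sum_far_le hA hI p hR hk)

/-! ## The dominating kernel -/

/-- **The dominating kernel** `k(p, q) = 248064·|p − q|⁻⁸` (`0` on the diagonal). [folklore] -/
def ker (p q : E3) : ℝ := if p = q then 0 else 248064 * (dist p q)⁻¹ ^ 8

/-- The kernel is nonnegative. [folklore] -/
theorem ker_nonneg (p q : E3) : 0 ≤ ker p q := by
  unfold ker; split_ifs <;> positivity

/-- The kernel vanishes on the diagonal. [folklore] -/
@[simp] theorem ker_self (p : E3) : ker p p = 0 := by simp [ker]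

/-- Off the diagonal the kernel is `248064·(dist p q)⁻⁸`. [folklore] -/
theorem ker_of_ne {p q : E3} (h : p ≠ q) : ker p q = 248064 * (dist p q)⁻¹ ^ 8 := by simp [ker, h]

/-- The kernel is symmetric. [folklore] -/
theorem ker_comm (p q : E3) : ker p q = ker q p := by
  by_cases h : p = q
  · rw [h]
  · rw [ker_of_ne h, ker_of_ne (Ne.symm h), dist_comm]

/-- At a site, the kernel row is `248064 ×` the far-field family with `R = 23/25`, `k = 5`. [folklore] -/
theorem ker_eq_far (hA : Adm₀ A) (hI : Inner₀ t A) {p : E3} (hp : p ∈ Sites₀ t A) (q : Sites₀ t A) :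
    ker p q = 248064 * (if (23 / 25 : ℝ) ≤ dist (q : E3) p then (dist (q : E3) p)⁻¹ ^ (5 + 3) else 0) := by
  by_cases h : p = q
  · have : ¬ ((23 / 25 : ℝ) ≤ dist (q : E3) p) := by rw [← h, dist_self]; norm_num
    rw [if_neg this, h, ker_self, mul_zero]
  · rw [ker_of_ne h, if_pos (by rw [dist_comm]; exact dist_sites_ge hA hI hp q.2 h), dist_comm]

/-- **Row summability of the kernel** over the sites. [folklore] -/
theorem summable_ker (hA : Adm₀ A) (hI : Inner₀ t A) {p : E3} (hp : p ∈ Sites₀ t A) :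
    Summable fun q : Sites₀ t A => ker p q := by
  simp only [ker_eq_far hA hI hp]
  exact (summable_far hA hI p le_rfl (by norm_num)).mul_left _

/-- **Row sum of the kernel**: `Σ_q k(p,q) ≤ 248064·1024/(23/25)⁸`. [folklore] -/
theorem tsum_ker_le (hA : Adm₀ A) (hI : Inner₀ t A) {p : E3} (hp : p ∈ Sites₀ t A) :
    ∑' q : Sites₀ t A, ker p q ≤ 248064 * (1024 / ((23 / 25 : ℝ) ^ 3 * (23 / 25 : ℝ) ^ 5)) := by
  simp only [ker_eq_far hA hI hp]
  rw [tsum_mul_left]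
  exact mul_le_mul_of_nonneg_left (tsum_far_le hA hI p le_rfl (by norm_num)) (by norm_num)

/-- Finite partial row sums of the kernel obey the same bound. [folklore] -/
theorem sum_ker_le (hA : Adm₀ A) (hI : Inner₀ t A) {p : E3} (hp : p ∈ Sites₀ t A) (F : Finset (Sites₀ t A)) :
    ∑ q ∈ F, ker p q ≤ 248064 * (1024 / ((23 / 25 : ℝ) ^ 3 * (23 / 25 : ℝ) ^ 5)) :=
  ((summable_ker hA hI hp).sum_le_tsum F fun _ _ => ker_nonneg _ _).trans (tsum_ker_le hA hI hp)

/-- **Far part of a kernel row** (finite form): `Σ_{q ∈ F, dist ≥ R} k(p,q) ≤ 248064·1024/((23/25)³R⁵)`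
for `R ≥ 23/25` and ANY centre `p`. [folklore] -/
theorem sum_ker_far_le (hA : Adm₀ A) (hI : Inner₀ t A) (p : E3) {R : ℝ} (hR : (23 / 25 : ℝ) ≤ R)
    (F : Finset (Sites₀ t A)) :
    ∑ q ∈ F, (if R ≤ dist (q : E3) p then ker p q else 0) ≤ 248064 * (1024 / ((23 / 25 : ℝ) ^ 3 * R ^ 5)) := by
  have h := sum_far_le hA hI p hR (by norm_num : 1 ≤ 5) F
  calc ∑ q ∈ F, (if R ≤ dist (q : E3) p then ker p q else 0)
      = ∑ q ∈ F, 248064 * (if R ≤ dist (q : E3) p then (dist (q : E3) p)⁻¹ ^ (5 + 3) else 0) := by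
        refine Finset.sum_congr rfl fun q _ => ?_
        split_ifs with hq
        · have hne : p ≠ (q : E3) := by
            intro hpq; rw [← hpq, dist_self] at hq; linarith
          rw [ker_of_ne hne, dist_comm]
        · rw [mul_zero]
    _ = 248064 * ∑ q ∈ F, (if R ≤ dist (q : E3) p then (dist (q : E3) p)⁻¹ ^ (5 + 3) else 0) := by
        rw [Finset.mul_sum]
    _ ≤ 248064 * (1024 / ((23 / 25 : ℝ) ^ 3 * R ^ 5)) := by gcongr

/-- **Near part of a kernel row, weighted by `dist²`** (finite form):
`Σ_{q ∈ F} dist(p,q)²·k(p,q) ≤ 248064·1024/(23/25)⁶` at a site `p`. [folklore] -/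
theorem sum_distSq_mul_ker_le (hA : Adm₀ A) (hI : Inner₀ t A) {p : E3} (hp : p ∈ Sites₀ t A)
    (F : Finset (Sites₀ t A)) :
    ∑ q ∈ F, dist (q : E3) p ^ 2 * ker p q ≤ 248064 * (1024 / ((23 / 25 : ℝ) ^ 3 * (23 / 25 : ℝ) ^ 3)) := by
  have h := sum_far_le hA hI p (le_rfl : (23 / 25 : ℝ) ≤ 23 / 25) (by norm_num : 1 ≤ 3) F
  calc ∑ q ∈ F, dist (q : E3) p ^ 2 * ker p q
      = ∑ q ∈ F, 248064 * (if (23 / 25 : ℝ) ≤ dist (q : E3) p then (dist (q : E3) p)⁻¹ ^ (3 + 3) else 0) := by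
        refine Finset.sum_congr rfl fun q _ => ?_
        rw [ker_eq_far hA hI hp q]
        split_ifs with hq
        · have hd : dist (q : E3) p ≠ 0 := by intro h0; rw [h0] at hq; norm_num at hq
          have h8 : (dist (q : E3) p)⁻¹ ^ (5 + 3) = (dist (q : E3) p)⁻¹ ^ (3 + 3) * (dist (q : E3) p)⁻¹ ^ 2 := by
            rw [← pow_add]
          have h1 : dist (q : E3) p ^ 2 * (dist (q : E3) p)⁻¹ ^ 2 = 1 := by
            rw [← mul_pow, mul_inv_cancel₀ hd, one_pow]
          calc dist (q : E3) p ^ 2 * (248064 * (dist (q : E3) p)⁻¹ ^ (5 + 3))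
              = 248064 * (dist (q : E3) p)⁻¹ ^ (3 + 3) * (dist (q : E3) p ^ 2 * (dist (q : E3) p)⁻¹ ^ 2) := by
                rw [h8]; ring
            _ = 248064 * (dist (q : E3) p)⁻¹ ^ (3 + 3) := by rw [h1, mul_one]
        · simp
    _ = 248064 * ∑ q ∈ F, (if (23 / 25 : ℝ) ≤ dist (q : E3) p then (dist (q : E3) p)⁻¹ ^ (3 + 3) else 0) := by
        rw [Finset.mul_sum]
    _ ≤ 248064 * (1024 / ((23 / 25 : ℝ) ^ 3 * (23 / 25 : ℝ) ^ 3)) := by gcongr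

/-! ## Counting sites in balls -/

/-- **Packing count**: a finite set of sites in the closed ball `dist · c ≤ r` has at most
`(2r/(23/25) + 1)³` elements. [folklore] -/
theorem card_sites_le' (hA : Adm₀ A) (hI : Inner₀ t A) (c : E3) {r : ℝ} (hr : 0 ≤ r) (F : Finset E3)
    (hF : ∀ s ∈ F, s ∈ Sites₀ t A ∧ dist s c ≤ r) : (F.card : ℝ) ≤ (2 * r / (23 / 25) + 1) ^ 3 := by
  have h := card_le_of_separated_of_dist_le F c (by norm_num : (0 : ℝ) < 23 / 25) hr
    (fun s hs => (hF s hs).2) (fun a ha b hb hab => dist_sites_ge hA hI (hF a ha).1 (hF b hb).1 hab)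
  rwa [finrank_euclideanSpace_fin] at h

/-- **Packing count, cubic form**: at most `32 r³` sites in a closed ball of radius `r ≥ 1`
(`(50/23 · 2 + 1)³ ≤ 32`). [folklore] -/
theorem card_sites_le (hA : Adm₀ A) (hI : Inner₀ t A) (c : E3) {r : ℝ} (hr : 1 ≤ r) (F : Finset (Sites₀ t A))
    (hF : ∀ q ∈ F, dist (q : E3) c ≤ r) : (F.card : ℝ) ≤ 32 * r ^ 3 := by
  have h := card_sites_le' hA hI c (by linarith) (F.map (Function.Embedding.subtype _)) ?_
  · rw [Finset.card_map] at h
    refine h.trans ?_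
    have h1 : 2 * r / (23 / 25) + 1 ≤ (73 / 23) * r := by
      rw [div_add_one (by norm_num), div_le_iff₀ (by norm_num)]; nlinarith
    calc (2 * r / (23 / 25) + 1) ^ 3 ≤ ((73 / 23) * r) ^ 3 := pow_le_pow_left₀ (by positivity) h1 3
      _ = (73 / 23) ^ 3 * r ^ 3 := by ring
      _ ≤ 32 * r ^ 3 := by gcongr; norm_num
  · intro s hs
    simp only [Finset.mem_map, Function.Embedding.coe_subtype] at hs
    obtain ⟨q, hq, rfl⟩ := hs
    exact ⟨q.2, hF q hq⟩

/-- The sites in a closed ball, as a finite set of the site subtype. [folklore] -/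
theorem finite_sites_ball (hA : Adm₀ A) (hI : Inner₀ t A) (c : E3) (r : ℝ) :
    Set.Finite {q : Sites₀ t A | dist (q : E3) c ≤ r} := by
  have h : Set.Finite ((Subtype.val : Sites₀ t A → E3) ⁻¹' {s : E3 | s ∈ Sites₀ t A ∧ dist s c ≤ r}) :=
    (finite_sites_dist_le hA hI c r).preimage Subtype.val_injective.injOn
  exact h.subset fun q hq => ⟨q.2, hq⟩

/-! ## Nearest-neighbour bonds are short -/

/-- **Nearest-neighbour bonds are short**: `dist p q ≤ 11/10` between sites forces `dist p q ≤ 51/50`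
(the registered site dichotomy `dist_sites_le_or_ge`). [folklore] -/
theorem dist_le_of_nn (hA : Adm₀ A) (hI : Inner₀ t A) {p q : E3} (hp : p ∈ Sites₀ t A) (hq : q ∈ Sites₀ t A)
    (h : dist p q ≤ 11 / 10) : dist p q ≤ 51 / 50 := by
  rcases dist_sites_le_or_ge t A hA hI p hp q hq with h' | h'
  · exact h'
  · linarith

/-! ## The anchor shift: sublattices, the maps `fwd` / `bwd`, the field `vField` -/

variable {τ : E3}

/-- A site of sublattice `0` is not a site of sublattice `1`. [folklore] -/
theorem ne_cross (hA : Adm₀ A) (hI : Inner₀ t A) {z z' : E3} (hz : z ∈ Λ₀) (hz' : z' ∈ Λ₀) :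
    t 0 + A z ≠ t 1 + A z' := by
  intro h
  have h1 := dist_sites_cross_ge hA hI hz hz'
  rw [h, dist_self] at h1
  norm_num at h1

/-- The shift field vanishes on sublattice `0`. [folklore] -/
theorem shiftField_sub0 (hA : Adm₀ A) (hI : Inner₀ t A) (τ : E3) {z : E3} (hz : z ∈ Λ₀) :
    shiftField t A τ (t 0 + A z) = 0 := by
  unfold shiftField
  rw [if_neg]
  rintro ⟨z', hz', h⟩
  exact ne_cross hA hI hz hz' h

/-- The shift field is `τ` on sublattice `1`. [folklore] -/
theorem shiftField_sub1 (t : Fin 2 → E3) (A : E3 →L[ℝ] E3) (τ : E3) {z : E3} (hz : z ∈ Λ₀) :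
    shiftField t A τ (t 1 + A z) = τ := by
  unfold shiftField
  rw [if_pos ⟨z, hz, rfl⟩]

/-- `‖τ𝟙₁‖ ≤ ‖τ‖` pointwise. [folklore] -/
theorem norm_shiftField_le (t : Fin 2 → E3) (A : E3 →L[ℝ] E3) (τ s : E3) : ‖shiftField t A τ s‖ ≤ ‖τ‖ := by
  unfold shiftField; split_ifs <;> simp

/-- Differences of the shift field have norm `≤ ‖τ‖`. [folklore] -/
theorem norm_shiftField_sub_le (t : Fin 2 → E3) (A : E3 →L[ℝ] E3) (τ s s' : E3) :
    ‖shiftField t A τ s - shiftField t A τ s'‖ ≤ ‖τ‖ := by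
  unfold shiftField; split_ifs <;> simp

/-- **The anchor is small**: `Inner₀ t A` and `Inner₀ (anchorDatum t τ) A` force `‖τ‖ ≤ 1/20`. [folklore] -/
theorem norm_anchor_le (hI : Inner₀ t A) (hIτ : Inner₀ (anchorDatum t τ) A) : ‖τ‖ ≤ 1 / 20 := by
  have h1 : ‖t 1 - t 0 - A (barlowOffset 1 + layerNormal (Real.sqrt (2 / 3)))‖ ≤ 1 / 40 := hI
  have h2 : ‖anchorDatum t τ 1 - anchorDatum t τ 0 - A (barlowOffset 1 + layerNormal (Real.sqrt (2 / 3)))‖ ≤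
      1 / 40 := hIτ
  rw [anchorDatum_one, anchorDatum_zero] at h2
  have h3 : τ = (t 1 + τ - t 0 - A (barlowOffset 1 + layerNormal (Real.sqrt (2 / 3)))) -
      (t 1 - t 0 - A (barlowOffset 1 + layerNormal (Real.sqrt (2 / 3)))) := by abel
  rw [h3]
  exact (norm_sub_le _ _).trans (by linarith)

/-- **Forward anchor map** `s ↦ s + τ𝟙₁(s)` (reference sites to anchored sites). [folklore] -/
def fwd (t : Fin 2 → E3) (A : E3 →L[ℝ] E3) (τ : E3) : E3 → E3 := fun s => s + shiftField t A τ s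

/-- **Backward anchor map** `p ↦ p − τ𝟙₁*(p)` (anchored sites to reference sites). [folklore] -/
def bwd (t : Fin 2 → E3) (A : E3 →L[ℝ] E3) (τ : E3) : E3 → E3 :=
  fun p => p - shiftField (anchorDatum t τ) A τ p

/-- **The displacement seen from the anchored sites**: `v(p) = u(bwd p) − τ𝟙₁*(p)`, so that
`p + v p = bwd p + u (bwd p)` is the particle attached to the reference site `bwd p`. [folklore] -/
def vField (t : Fin 2 → E3) (A : E3 →L[ℝ] E3) (τ : E3) (u : E3 → E3) : E3 → E3 :=
  fun p => u (bwd t A τ p) - shiftField (anchorDatum t τ) A τ p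

/-- `fwd` on sublattice `0`. [folklore] -/
theorem fwd_sub0 (hA : Adm₀ A) (hI : Inner₀ t A) {z : E3} (hz : z ∈ Λ₀) :
    fwd t A τ (t 0 + A z) = anchorDatum t τ 0 + A z := by
  rw [fwd, shiftField_sub0 hA hI τ hz, add_zero, anchorDatum_zero]

/-- `fwd` on sublattice `1`. [folklore] -/
theorem fwd_sub1 (t : Fin 2 → E3) (A : E3 →L[ℝ] E3) (τ : E3) {z : E3} (hz : z ∈ Λ₀) :
    fwd t A τ (t 1 + A z) = anchorDatum t τ 1 + A z := by
  rw [fwd, shiftField_sub1 t A τ hz, anchorDatum_one]; abel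

/-- `bwd` on sublattice `0`. [folklore] -/
theorem bwd_sub0 (hA : Adm₀ A) (hIτ : Inner₀ (anchorDatum t τ) A) {z : E3} (hz : z ∈ Λ₀) :
    bwd t A τ (anchorDatum t τ 0 + A z) = t 0 + A z := by
  rw [bwd, shiftField_sub0 hA hIτ τ hz, anchorDatum_zero, sub_zero]

/-- `bwd` on sublattice `1`. [folklore] -/
theorem bwd_sub1 (t : Fin 2 → E3) (A : E3 →L[ℝ] E3) (τ : E3) {z : E3} (hz : z ∈ Λ₀) :
    bwd t A τ (anchorDatum t τ 1 + A z) = t 1 + A z := by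
  rw [bwd, shiftField_sub1 _ A τ hz, anchorDatum_one]; abel

/-- `fwd` maps reference sites to anchored sites. [folklore] -/
theorem fwd_mem (hA : Adm₀ A) (hI : Inner₀ t A) {s : E3} (hs : s ∈ Sites₀ t A) :
    fwd t A τ s ∈ Sites₀ (anchorDatum t τ) A := by
  obtain ⟨m, z, hz, rfl⟩ := hs
  fin_cases m
  · exact ⟨0, z, hz, fwd_sub0 hA hI hz⟩
  · exact ⟨1, z, hz, fwd_sub1 t A τ hz⟩

/-- `bwd` maps anchored sites to reference sites. [folklore] -/
theorem bwd_mem (hA : Adm₀ A) (hIτ : Inner₀ (anchorDatum t τ) A) {p : E3} (hp : p ∈ Sites₀ (anchorDatum t τ) A) :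
    bwd t A τ p ∈ Sites₀ t A := by
  obtain ⟨m, z, hz, rfl⟩ := hp
  fin_cases m
  · exact ⟨0, z, hz, bwd_sub0 hA hIτ hz⟩
  · exact ⟨1, z, hz, bwd_sub1 t A τ hz⟩

/-- `bwd ∘ fwd = id` on the reference sites. [folklore] -/
theorem bwd_fwd (hA : Adm₀ A) (hI : Inner₀ t A) (hIτ : Inner₀ (anchorDatum t τ) A) {s : E3} (hs : s ∈ Sites₀ t A) :
    bwd t A τ (fwd t A τ s) = s := by
  obtain ⟨m, z, hz, rfl⟩ := hs
  fin_cases m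
  · simp only [Fin.zero_eta]; rw [fwd_sub0 hA hI hz, bwd_sub0 hA hIτ hz]
  · simp only [Fin.mk_one]; rw [fwd_sub1 t A τ hz, bwd_sub1 t A τ hz]

/-- `fwd ∘ bwd = id` on the anchored sites. [folklore] -/
theorem fwd_bwd (hA : Adm₀ A) (hI : Inner₀ t A) (hIτ : Inner₀ (anchorDatum t τ) A) {p : E3}
    (hp : p ∈ Sites₀ (anchorDatum t τ) A) : fwd t A τ (bwd t A τ p) = p := by
  obtain ⟨m, z, hz, rfl⟩ := hp
  fin_cases m
  · simp only [Fin.zero_eta]; rw [bwd_sub0 hA hIτ hz, fwd_sub0 hA hI hz]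
  · simp only [Fin.mk_one]; rw [bwd_sub1 t A τ hz, fwd_sub1 t A τ hz]

/-- The two shift fields correspond under `fwd`. [folklore] -/
theorem shiftField_fwd (hA : Adm₀ A) (hI : Inner₀ t A) (hIτ : Inner₀ (anchorDatum t τ) A) {s : E3}
    (hs : s ∈ Sites₀ t A) : shiftField (anchorDatum t τ) A τ (fwd t A τ s) = shiftField t A τ s := by
  obtain ⟨m, z, hz, rfl⟩ := hs
  fin_cases m
  · simp only [Fin.zero_eta]
    rw [fwd_sub0 hA hI hz, shiftField_sub0 hA hIτ τ hz, shiftField_sub0 hA hI τ hz]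
  · simp only [Fin.mk_one]
    rw [fwd_sub1 t A τ hz, shiftField_sub1 _ A τ hz, shiftField_sub1 t A τ hz]

/-- **`vField ∘ fwd` is the field `u − τ𝟙₁` of the stub's conclusion.** [folklore] -/
theorem vField_fwd (hA : Adm₀ A) (hI : Inner₀ t A) (hIτ : Inner₀ (anchorDatum t τ) A) (u : E3 → E3) {s : E3}
    (hs : s ∈ Sites₀ t A) : vField t A τ u (fwd t A τ s) = u s - shiftField t A τ s := by
  rw [vField, bwd_fwd hA hI hIτ hs, shiftField_fwd hA hI hIτ hs]

/-- The particle attached to an anchored site: `p + v p = bwd p + u (bwd p)`. [folklore] -/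
theorem add_vField (t : Fin 2 → E3) (A : E3 →L[ℝ] E3) (τ : E3) (u : E3 → E3) (p : E3) :
    p + vField t A τ u p = bwd t A τ p + u (bwd t A τ p) := by
  simp only [vField, bwd]; abel

/-- The endpoint configuration sits in the `1/40`-box of the original datum: `v p + τ𝟙₁*(p) = u (bwd p)`.
[folklore] -/
theorem vField_add_shiftField (t : Fin 2 → E3) (A : E3 →L[ℝ] E3) (τ : E3) (u : E3 → E3) (p : E3) :
    vField t A τ u p + shiftField (anchorDatum t τ) A τ p = u (bwd t A τ p) := by
  simp only [vField]; abel

/-- `‖v p‖ ≤ 3/40` on the anchored sites. [folklore] -/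
theorem norm_vField_le {X : Set E3} {u : E3 → E3} (hA : Adm₀ A) (hI : Inner₀ t A)
    (hIτ : Inner₀ (anchorDatum t τ) A) (hu : IsDisplacement X t A u) {p : E3}
    (hp : p ∈ Sites₀ (anchorDatum t τ) A) : ‖vField t A τ u p‖ ≤ 3 / 40 := by
  have h1 : ‖u (bwd t A τ p)‖ ≤ 1 / 40 := hu.1 _ (bwd_mem hA hIτ hp)
  have h2 := norm_shiftField_le (anchorDatum t τ) A τ p
  have h3 := norm_anchor_le hI hIτ
  exact (norm_sub_le _ _).trans (by linarith)

/-- `‖v p − v q‖ ≤ 3/20` on the anchored sites. [folklore] -/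
theorem norm_vField_sub_le {X : Set E3} {u : E3 → E3} (hA : Adm₀ A) (hI : Inner₀ t A)
    (hIτ : Inner₀ (anchorDatum t τ) A) (hu : IsDisplacement X t A u) {p q : E3}
    (hp : p ∈ Sites₀ (anchorDatum t τ) A) (hq : q ∈ Sites₀ (anchorDatum t τ) A) :
    ‖vField t A τ u p - vField t A τ u q‖ ≤ 3 / 20 :=
  (norm_sub_le _ _).trans (by linarith [norm_vField_le hA hI hIτ hu hp, norm_vField_le hA hI hIτ hu hq])

/-- `fwd` moves points by at most `‖τ‖`. [folklore] -/
theorem dist_fwd_le (t : Fin 2 → E3) (A : E3 →L[ℝ] E3) (τ s c : E3) : dist (fwd t A τ s) c ≤ dist s c + ‖τ‖ := by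
  rw [fwd, dist_eq_norm, dist_eq_norm, add_sub_right_comm]
  exact (norm_add_le _ _).trans (by linarith [norm_shiftField_le t A τ s])

/-- **Nearest-neighbour bonds survive the anchor shift**: `dist s s' ≤ 11/10` between reference sites
gives `dist (fwd s) (fwd s') ≤ 51/50 + 1/20 ≤ 11/10`. [folklore] -/
theorem dist_fwd_fwd_le_of_nn (hA : Adm₀ A) (hI : Inner₀ t A) (hIτ : Inner₀ (anchorDatum t τ) A) {s s' : E3}
    (hs : s ∈ Sites₀ t A) (hs' : s' ∈ Sites₀ t A) (h : dist s s' ≤ 11 / 10) :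
    dist (fwd t A τ s) (fwd t A τ s') ≤ 11 / 10 := by
  have h1 := dist_le_of_nn hA hI hs hs' h
  have h2 := norm_shiftField_sub_le t A τ s s'
  have h3 := norm_anchor_le hI hIτ
  have h4 : fwd t A τ s - fwd t A τ s' = (s - s') + (shiftField t A τ s - shiftField t A τ s') := by
    simp only [fwd]; abel
  rw [dist_eq_norm, h4]
  rw [dist_eq_norm] at h1
  exact (norm_add_le _ _).trans (by linarith)

end LevelOne

/-- Registered sub-goal carrying this helper file (crux stmt-AtomisticToContinuum-9332, line `Sketch`, level 1):
nearest-neighbour bonds of the reference sites survive the anchor shift `s ↦ s + τ𝟙₁(s)`. [folklore] -/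
theorem levelOne_geometry : ∀ (t : Fin 2 → E3) (A : E3 →L[ℝ] E3) (τ : E3), Adm₀ A → Inner₀ t A → Inner₀ (anchorDatum t τ) A → ∀ p ∈ Sites₀ t A, ∀ q ∈ Sites₀ t A, dist p q ≤ 11 / 10 → dist (p + shiftField t A τ p) (q + shiftField t A τ q) ≤ 11 / 10 := by
  intro t A τ hA hI hIτ p hp q hq h
  exact LevelOne.dist_fwd_fwd_le_of_nn hA hI hIτ hp hq h

end Summit.AtomisticToContinuum.Crystallization.Theorems.ExcessDecayLiouville

end
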